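import Summits.ABC.ABC.Theses.FeketeScales
import Summits.ABC.ABC.Theorems.FeketeScalesSubmultOfRST

/-!
# `CyclotomicPowerfulSubpower` is false — negative lemma for crux stmt-ABC-2160

Card `power-shape-cyclotomic-descent` (crux-ideate round 1 for
`Summit.ABC.ABC.Theses.FeketeScales.ScaleSubmultiplicativity`; workfile
`Cruxes/ScaleSubmultiplicativity/Ideator1Sketch.lean`) reduces the crux restricted to power-shaped
triples `(xⁿ, zⁿ - xⁿ, zⁿ)` to the residual `Ideator1.CyclotomicPowerfulSubpower`: the cyclotomic
cofactor `Φ = (zⁿ - xⁿ)/(z - x)` should have SUB-POWER powerful part,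
`Φ ≤ K · exp((log zⁿ)^θ) · rad Φ` for some `θ < 1`, `K > 0`, uniformly in `n ≥ 2` and coprime
`0 < x < z`.  This file refutes that residual, restated verbatim (so `not_cyclotomicPowerfulSubpower`
is definitionally `¬ Ideator1.CyclotomicPowerfulSubpower`): already for `n = 2`, `x = 1`,
`z = 2ᵏ - 1` the cofactor is `z + 1 = 2ᵏ` with radical `2`, so its powerful excess `(k - 1) log 2`
is LINEAR in `log z²`, not sub-power.  (On paper the same failure occurs for every fixed `n ≥ 3`:
Eisenstein norms `z² + zx + x² = 7ᵐ` for `n = 3`, Gaussian norms for `n = 4`, an index-`p²` lattice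
in general — crux triage `TRIAGE-r1-1.md`.)  Consequences recorded for the crux chain: the card's
partial transfer `crux_at_natural_splitting_of_powerShape (h : CyclotomicPowerfulSubpower)` is
vacuous, and a Wieferich-type residual for power shapes can only be orbit-wise (fixed base), never
uniform in the base.  Helper file `--supports stmt-ABC-2160`; it asserts no Theses statement.
-/

-- `Summit.<Summit>.<Problem>` is the mandated summit-side namespace (CONVENTIONS §2).
set_option linter.dupNamespace false

namespace Summit.ABC.ABC.Theorems.ScaleSubmultiplicativity.Negative

open Summit.ABC.ABC.Theorems

/-- The `n = 2`, `x = 1`, `z = j + 1` slice of the cyclotomic cofactor: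
`((j+1)² - 1)/((j+1) - 1) = j + 2` for `j > 0`. [folklore] -/
theorem cofactor_sq_one (j : ℕ) (hj : 0 < j) :
    ((j + 1) ^ 2 - 1 ^ 2) / (j + 1 - 1) = j + 2 := by
  have hsub : (j + 1) ^ 2 - 1 ^ 2 = j * (j + 2) :=
    Nat.sub_eq_of_eq_add (by ring)
  rw [hsub, Nat.add_sub_cancel, Nat.mul_div_cancel_left _ hj]

/-- **The residual of card `power-shape-cyclotomic-descent` is false**: there are no `θ < 1`, `K > 0`
with `(zⁿ - xⁿ)/(z - x) ≤ K · exp((log zⁿ)^θ) · rad((zⁿ - xⁿ)/(z - x))` for all `n ≥ 2` and coprime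
`0 < x < z` — witness `n = 2`, `x = 1`, `z = 2ᵏ - 1` (cofactor `2ᵏ`, radical `2`). [folklore] -/
theorem not_cyclotomicPowerfulSubpower :
    ¬ (∃ θ : ℝ, θ < 1 ∧ ∃ K : ℝ, 0 < K ∧ ∀ n x z : ℕ, 2 ≤ n → 0 < x → x < z → Nat.Coprime x z →
      (((z ^ n - x ^ n) / (z - x) : ℕ) : ℝ) ≤
        K * Real.exp (Real.log ((z : ℝ) ^ n) ^ θ) *
          (UniqueFactorizationMonoid.radical ((z ^ n - x ^ n) / (z - x)) : ℕ)) := by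
  rintro ⟨θ, hθ1, K, hK, h⟩
  -- exponent bookkeeping: `t = max θ 0 ∈ [0, 1)`
  set t : ℝ := max θ 0 with ht_def
  have ht0 : 0 ≤ t := le_max_right _ _
  have ht1 : t < 1 := max_lt hθ1 one_pos
  have hs : 0 < 1 - t := by linarith
  -- two thresholds in the scale `P = 2ᵏ`: `4 ≤ (log P)^(1-t)` and `2 log(2K) + 1 ≤ log P`
  obtain ⟨N₁, hN₁⟩ := SubmultOfRST.exists_threshold 4 hs
  obtain ⟨N₂, hN₂⟩ := SubmultOfRST.exists_threshold (2 * Real.log (2 * K) + 1) one_pos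
  set k : ℕ := N₁ + N₂ + 2 with hk_def
  have hk2 : 2 ≤ k := by omega
  have hkpow : k < 2 ^ k := Nat.lt_two_pow_self
  have h4 : 4 ≤ 2 ^ k := by
    calc 4 = 2 ^ 2 := by norm_num
      _ ≤ 2 ^ k := Nat.pow_le_pow_right (by norm_num) hk2
  -- the witness `z = j + 1` with `j + 2 = 2ᵏ`
  obtain ⟨j, hj⟩ : ∃ j : ℕ, 2 ^ k = j + 2 := ⟨2 ^ k - 2, by omega⟩
  have hj0 : 0 < j := by omega
  have hz := h 2 1 (j + 1) le_rfl one_pos (by omega) (Nat.coprime_one_left _)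
  rw [cofactor_sq_one j hj0, ← hj,
    UniqueFactorizationMonoid.radical_pow_of_prime (Nat.prime_iff.mp Nat.prime_two) (by omega : k ≠ 0)]
    at hz
  simp only [normalize_eq] at hz
  -- real-variable form: `M = 2ᵏ`, `L = log M`, `zr = j + 1 = M - 1`
  set M : ℝ := ((2 ^ k : ℕ) : ℝ) with hM_def
  set L : ℝ := Real.log M with hL_def
  have hM4 : (4 : ℝ) ≤ M := by rw [hM_def]; exact_mod_cast h4
  have hM0 : 0 < M := by linarith
  have hzM : ((j + 1 : ℕ) : ℝ) + 1 = M := by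
    rw [hM_def, hj]; push_cast; ring
  have hz3 : (3 : ℝ) ≤ ((j + 1 : ℕ) : ℝ) := by linarith
  have hz0 : (0 : ℝ) < ((j + 1 : ℕ) : ℝ) := by linarith
  have hzleM : ((j + 1 : ℕ) : ℝ) ≤ M := by linarith
  -- thresholds at `P = 2ᵏ ≥ k ≥ Nᵢ`
  have hT₁ : 4 ≤ L ^ (1 - t) := hN₁ (2 ^ k) (by omega)
  have hT₂ : 2 * Real.log (2 * K) + 1 ≤ L := by
    have := hN₂ (2 ^ k) (by omega)
    rwa [Real.rpow_one] at this
  have hL0 : 0 < L := Real.log_pos (by linarith)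
  -- `(log z²)^θ ≤ 2 L^t ≤ L/2`
  have hlogz2 : Real.log (((j + 1 : ℕ) : ℝ) ^ 2) ≤ 2 * L := by
    have hll : Real.log ((j + 1 : ℕ) : ℝ) ≤ L := Real.log_le_log hz0 hzleM
    have h2 : Real.log (((j + 1 : ℕ) : ℝ) ^ 2) = 2 * Real.log ((j + 1 : ℕ) : ℝ) := by
      rw [Real.log_pow]; norm_num
    rw [h2]; linarith
  have hlogz2_one : 1 ≤ Real.log (((j + 1 : ℕ) : ℝ) ^ 2) := by
    rw [Real.le_log_iff_exp_le (by positivity)]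
    have := Real.exp_one_lt_d9
    nlinarith
  have hLt0 : 0 ≤ L ^ t := Real.rpow_nonneg hL0.le t
  have hE : Real.log (((j + 1 : ℕ) : ℝ) ^ 2) ^ θ ≤ 2 * L ^ t := by
    have h2L : (2 * L) ^ t ≤ 2 * L ^ t := by
      rw [Real.mul_rpow (by norm_num) hL0.le]
      have h2t : (2 : ℝ) ^ t ≤ 2 := by
        calc (2 : ℝ) ^ t ≤ 2 ^ (1 : ℝ) := Real.rpow_le_rpow_of_exponent_le (by norm_num) ht1.le
          _ = 2 := Real.rpow_one 2
      exact mul_le_mul_of_nonneg_right h2t hLt0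
    rcases le_or_gt 0 θ with hθ | hθ
    · have htθ : t = θ := max_eq_left hθ
      calc Real.log (((j + 1 : ℕ) : ℝ) ^ 2) ^ θ ≤ (2 * L) ^ θ :=
            Real.rpow_le_rpow (by linarith) hlogz2 hθ
        _ = (2 * L) ^ t := by rw [htθ]
        _ ≤ 2 * L ^ t := h2L
    · have htz : t = 0 := max_eq_right hθ.le
      calc Real.log (((j + 1 : ℕ) : ℝ) ^ 2) ^ θ ≤ 1 :=
            Real.rpow_le_one_of_one_le_of_nonpos hlogz2_one hθ.le
        _ ≤ 2 * L ^ t := by rw [htz, Real.rpow_zero]; norm_num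
  have hLsplit : L = L ^ t * L ^ (1 - t) := by
    calc L = L ^ (1 : ℝ) := (Real.rpow_one L).symm
      _ = L ^ (t + (1 - t)) := by congr 1; ring
      _ = L ^ t * L ^ (1 - t) := Real.rpow_add hL0 _ _
  have hEL : 2 * L ^ t ≤ L / 2 := by
    have : 4 * L ^ t ≤ L := by
      calc 4 * L ^ t = L ^ t * 4 := mul_comm _ _
        _ ≤ L ^ t * L ^ (1 - t) := mul_le_mul_of_nonneg_left hT₁ hLt0
        _ = L := hLsplit.symm
    linarith
  -- from the residual: `M ≤ 2K · exp(L/2)`, i.e. `exp(L/2) ≤ 2K`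
  have hexpL : Real.exp L = M := by rw [hL_def, Real.exp_log hM0]
  have hmain : M ≤ 2 * K * Real.exp (L / 2) := by
    have hexp_le : Real.exp (Real.log (((j + 1 : ℕ) : ℝ) ^ 2) ^ θ) ≤ Real.exp (L / 2) :=
      Real.exp_le_exp.mpr (hE.trans hEL)
    calc M = ((2 ^ k : ℕ) : ℝ) := rfl
      _ ≤ K * Real.exp (Real.log (((j + 1 : ℕ) : ℝ) ^ 2) ^ θ) * ((2 : ℕ) : ℝ) := hz
      _ = 2 * K * Real.exp (Real.log (((j + 1 : ℕ) : ℝ) ^ 2) ^ θ) := by push_cast; ring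
      _ ≤ 2 * K * Real.exp (L / 2) := mul_le_mul_of_nonneg_left hexp_le (by positivity)
  have hhalf : Real.exp (L / 2) ≤ 2 * K := by
    have hprod : Real.exp (L / 2) * Real.exp (L / 2) = M := by
      rw [← Real.exp_add, add_halves, hexpL]
    have hpos : 0 < Real.exp (L / 2) := Real.exp_pos _
    nlinarith
  -- hence `L ≤ 2 log(2K)`, contradicting the second threshold
  have h2K : 0 < 2 * K := by positivity
  have hLle : L / 2 ≤ Real.log (2 * K) := by
    rw [Real.le_log_iff_exp_le h2K]
    exact hhalf
  linarith

end Summit.ABC.ABC.Theorems.ScaleSubmultiplicativity.Negative
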